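import Summits.PneNP.PneNP.Theorems.SignDeg2AvoidAffineSplitMachine

/-!
# ROUND-18 item K3 `AffineSplit k` — part 2/3: correctness of the affine-split machine

Cell pnp-ideate (route packet `SignDeg2Avoid`, item K3).  For the machine `affStr k f₀` of part 1
(`SignDeg2AvoidAffineSplitMachine`):

* an AFFINE table is a parity plus a constant: `bit (P u) = bit (P 0) + Σ_{i ∈ S} bit (u_i)` in `𝔽₂`
  (`bit_apply_of_aff`, from `bsgn ∘ P = ±χ_S` and `χ_S(u) = (−1)^{#{i ∈ S : u_i}}`), so an affine output reads
  `bit (cbit j) + ⟨χ_x, row_j⟩` (`bit_eval_of_aff`);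
* BRANCH A: among `≥ n + 1` vectors of `𝔽₂ⁿ` some one lies in the span of the earlier ones
  (`exists_mem_span_prev`, by `linearIndependent_finSnoc` and `fintype_card_le_finrank`), so the span test
  finds the first dependent affine row (`tStar_spec`); if the printed string were `I(x)`, the pairing `⟨χ_x, ·⟩`
  would kill every earlier affine row, hence their span, hence the dependent row — whose bit was flipped
  (`correct_A`);
* BRANCH B: the non-affine outputs form a sub-instance `subInst I` on the same inputs with all tables of
  sign-degree `≤ 2` and `≥ m − n ≥ C₀·n` outputs, whose code is exactly what the machine feeds to `f₀`
  (`subCode_outsOf`); a preimage of the printed string would be a preimage of `f₀`'s answer (`correct_B`).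

Hence `affStr_correct`: at stretch `m ≥ (C₀ + 1)·n` the machine avoids the range of every instance with all
tables of sign-degree `≤ 2` or affine.  Restricted-model algorithmic infrastructure; nothing here bears on
`P` versus `NP`.
-/

set_option linter.dupNamespace false -- `Summit.PneNP.PneNP.…`: summit = sub-problem name (D-0017 single-conjunct layout)

namespace Summit.PneNP.PneNP.Theorems.AffineSplitFP

open Literature.Computability.Complexity
open Summit.PneNP.PneNP.Theorems.SignDeg2Signing (IsAffinePred)
open Summit.PneNP.PneNP.Theorems.MajLocalAvoidFP (rowOf length_rowOf getD_rowOf)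
open Summit.PneNP.PneNP.Theorems.LocalMapDecodeFP (tabOf blockOf encode_eq outsOf)
open Summit.PneNP.PneNP.Theorems.Nc03Reduction (inSpan inSpan_iff Vec vecL vecL_nil vecL_cons ind bit chi chi_dot_ind)

variable {k n m : ℕ}

/-! ## Affine tables are parities -/

/-- `χ_S(u) = (−1)^{#{i ∈ S : u_i}}`. -/
theorem chiQ_eq_neg_one_pow (S : Finset (Fin k)) (u : Fin k → Bool) :
    chiQ S u = (-1 : ℚ) ^ (S.filter fun i => u i = true).card := by
  have h : ∀ i ∈ S, bsgn (u i) = (-1 : ℚ) ^ (if u i = true then 1 else 0) := by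
    intro i _; cases u i <;> simp [bsgn]
  unfold chiQ
  rw [Finset.prod_congr rfl h, Finset.prod_pow_eq_pow_sum, Finset.card_filter]

/-- `#{i ∈ S : u_i} ≡ Σ_{i ∈ S} bit (u_i)` in `𝔽₂`. -/
theorem natCast_card_filter (S : Finset (Fin k)) (u : Fin k → Bool) :
    (((S.filter fun i => u i = true).card : ℕ) : ZMod 2) = ∑ i ∈ S, bit (u i) := by
  rw [Finset.card_filter, Nat.cast_sum]
  refine Finset.sum_congr rfl fun i _ => ?_
  cases u i <;> simp [bit]

/-- `bsgn b = 1` forces `b = false`. -/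
theorem eq_false_of_bsgn {b : Bool} (h : bsgn b = 1) : b = false := by
  cases b
  · rfl
  · norm_num [bsgn] at h

/-- `bsgn b = −1` forces `b = true`. -/
theorem eq_true_of_bsgn {b : Bool} (h : bsgn b = -1) : b = true := by
  cases b
  · norm_num [bsgn] at h
  · rfl

/-- **An affine table is a parity plus a constant**: `bit (P u) = bit (P 0) + Σ_{i ∈ S} bit (u_i)` in `𝔽₂`,
`S` the chosen support. -/
theorem bit_apply_of_aff (P : (Fin k → Bool) → Bool) (h : IsAffinePred P) (u : Fin k → Bool) :
    bit (P u) = bit (P fun _ => false) + ∑ i ∈ affSupp P h, bit (u i) := by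
  rw [← natCast_card_filter]
  set c := ((affSupp P h).filter fun i => u i = true).card
  have hu : chiQ (affSupp P h) u = (-1 : ℚ) ^ c := chiQ_eq_neg_one_pow _ u
  have h0 : chiQ (affSupp P h) (fun _ => false) = 1 := by rw [chiQ_eq_neg_one_pow]; simp
  rcases affSupp_spec P h with hP | hP
  · rw [eq_false_of_bsgn (b := P fun _ => false) (by rw [hP, h0])]
    rcases Nat.even_or_odd c with hc | hc
    · rw [eq_false_of_bsgn (b := P u) (by rw [hP, hu, hc.neg_one_pow]), (ZMod.natCast_eq_zero_iff_even).2 hc]; rfl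
    · rw [eq_true_of_bsgn (b := P u) (by rw [hP, hu, hc.neg_one_pow]), (ZMod.natCast_eq_one_iff_odd).2 hc]; rfl
  · rw [eq_true_of_bsgn (b := P fun _ => false) (by rw [hP, h0])]
    rcases Nat.even_or_odd c with hc | hc
    · rw [eq_true_of_bsgn (b := P u) (by rw [hP, hu, hc.neg_one_pow]), (ZMod.natCast_eq_zero_iff_even).2 hc]; rfl
    · rw [eq_false_of_bsgn (b := P u) (by rw [hP, hu, hc.neg_one_pow]; norm_num), (ZMod.natCast_eq_one_iff_odd).2 hc]; rfl

/-! ## Rows as `𝔽₂`-vectors -/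

/-- Pairing `χ_x` with the vector of a list of positions reads the sum of those bits. -/
theorem chi_dot_vecL (x : Fin n → Bool) :
    ∀ T : List (Fin n), chi x ⬝ᵥ vecL n (T.map Fin.val) = (T.map fun v => bit (x v)).sum
  | [] => by rw [List.map_nil, vecL_nil, dotProduct_zero, List.map_nil, List.sum_nil]
  | v :: T => by
    rw [List.map_cons, vecL_cons, dotProduct_add, chi_dot_ind, chi_dot_vecL x T, List.map_cons, List.sum_cons]

/-- The row of an affine output: the positions read at the chosen support. -/
theorem rowL_eq (I : LocalMap k n m) (j : Fin m) (h : IsAffinePred (I.table j)) :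
    rowL I j = (((affSupp _ h).toList.map fun i => I.vars j i).map Fin.val) := by
  unfold rowL
  rw [affData_of_aff _ h, List.map_map, List.map_map]
  exact List.map_congr_left fun i _ => getD_rowOf I j i

/-- The constant bit of an affine output is its table at `0…0`. -/
theorem cbit_eq (I : LocalMap k n m) (j : Fin m) (h : IsAffinePred (I.table j)) : cbit I j = I.table j fun _ => false := by
  unfold cbit; rw [affData_of_aff _ h]

/-- **An affine output reads `bit (cbit j) + ⟨χ_x, row_j⟩`.** -/
theorem bit_eval_of_aff (I : LocalMap k n m) (j : Fin m) (h : IsAffinePred (I.table j)) (x : Fin n → Bool) :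
    bit (I.eval x j) = bit (cbit I j) + chi x ⬝ᵥ vecL n (rowL I j) := by
  rw [rowL_eq I j h, chi_dot_vecL, List.map_map, cbit_eq I j h, LocalMap.eval, bit_apply_of_aff _ h]
  congr 1
  rw [Finset.sum_map_toList]
  rfl

/-- A vector paired to zero with a set pairs to zero with its span. -/
theorem dot_eq_zero_of_mem_span {z w : Vec n} {S : Set (Vec n)} (hS : ∀ s ∈ S, z ⬝ᵥ s = 0)
    (hw : w ∈ Submodule.span (ZMod 2) S) : z ⬝ᵥ w = 0 := by
  induction hw using Submodule.span_induction with
  | mem s hs => exact hS s hs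
  | zero => exact dotProduct_zero z
  | add a b _ _ ha hb => rw [dotProduct_add, ha, hb, add_zero]
  | smul c a _ ha => rw [dotProduct_smul, ha, smul_zero]

/-! ## Branch A: a dependent affine row exists and is found -/

/-- **Among `n + 1` vectors of `𝔽₂ⁿ`, some one lies in the span of the earlier ones.** -/
theorem exists_mem_span_prev (w : ℕ → Vec n) : ∃ t, t < n + 1 ∧ w t ∈ Submodule.span (ZMod 2) (w '' {s | s < t}) := by
  by_contra hcon
  push Not at hcon
  have key : ∀ N, N ≤ n + 1 → LinearIndependent (ZMod 2) (fun i : Fin N => w i.val) := by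
    intro N
    induction N with
    | zero => intro _; exact linearIndependent_empty_type
    | succ N ih =>
      intro hN
      have hr : Set.range (fun i : Fin N => w i.val) = w '' {s | s < N} := by
        ext v
        simp only [Set.mem_range, Set.mem_image, Set.mem_setOf_eq]
        constructor
        · rintro ⟨i, rfl⟩; exact ⟨i.val, i.isLt, rfl⟩
        · rintro ⟨s, hs, rfl⟩; exact ⟨⟨s, hs⟩, rfl⟩
      have hw : w N ∉ Submodule.span (ZMod 2) (Set.range fun i : Fin N => w i.val) := by
        rw [hr]; exact hcon N (by omega)
      have h := (ih (by omega)).finSnoc hw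
      have he : (Fin.snoc (fun i : Fin N => w i.val) (w N) : Fin (N + 1) → Vec n) = fun i : Fin (N + 1) => w i.val := by
        funext i
        refine Fin.lastCases ?_ (fun i' => ?_) i
        · rw [Fin.snoc_last, Fin.val_last]
        · rw [Fin.snoc_castSucc, Fin.val_castSucc]
      rwa [he] at h
  have h := (key (n + 1) le_rfl).fintype_card_le_finrank
  simp only [Fintype.card_fin, Module.finrank_fintype_fun_eq_card] at h
  omega

/-- **The span test finds a dependent row** among `≥ N + 1` rows: `tStar` is a genuine position whose row lies
in the span of the earlier rows. -/
theorem tStar_spec (N : ℕ) (rows : List (List ℕ)) (hN : N + 1 ≤ rows.length) :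
    tStar N rows < rows.length ∧ inSpan N (rows.take (tStar N rows)) (rows.getD (tStar N rows) []) = true := by
  obtain ⟨t, ht, hmem⟩ := exists_mem_span_prev (n := N) fun s => vecL N (rows.getD s [])
  have hwit : inSpan N (rows.take t) (rows.getD t []) = true := by
    rw [inSpan_iff]
    refine Submodule.span_mono ?_ hmem
    rintro _ ⟨s, hs, rfl⟩
    have hst : s < t := hs
    have hsl : s < rows.length := by omega
    refine ⟨rows.getD s [], ?_, rfl⟩
    rw [List.getD_eq_getElem?_getD, List.getElem?_eq_getElem hsl, Option.getD_some]
    have e : rows[s] = (rows.take t)[s]'(by rw [List.length_take]; omega) := (List.getElem_take).symm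
    rw [e]; exact List.getElem_mem _
  have hlt : (List.range rows.length).findIdx (fun t => inSpan N (rows.take t) (rows.getD t [])) <
      (List.range rows.length).length :=
    List.findIdx_lt_length_of_exists ⟨t, List.mem_range.2 (by omega), hwit⟩
  have hp := List.findIdx_getElem (w := hlt)
  rw [List.getElem_range] at hp
  rw [List.length_range] at hlt
  exact ⟨hlt, hp⟩

/-- Membership in the list of affine outputs. -/
theorem aff_of_mem_affList {I : LocalMap k n m} {j : Fin m} (h : j ∈ affList I) : aff I j = true := by
  unfold affList at h; exact (List.mem_filter.1 h).2

/-- The list of affine outputs has no duplicates. -/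
theorem nodup_affList (I : LocalMap k n m) : (affList I).Nodup := (List.nodup_finRange m).filter _

/-- Members of a prefix of a mapped list. -/
theorem mem_take_map {α β : Type} (f : α → β) (l : List α) (t : ℕ) {r : β} (hr : r ∈ (l.map f).take t) :
    ∃ s, ∃ hs : s < l.length, s < t ∧ r = f l[s] := by
  rw [← List.map_take] at hr
  obtain ⟨a, ha, rfl⟩ := List.mem_map.1 hr
  obtain ⟨s, hs, rfl⟩ := List.getElem_of_mem ha
  rw [List.length_take] at hs
  exact ⟨s, by omega, by omega, by rw [List.getElem_take]⟩

/-- **Correctness, branch A.** -/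
theorem correct_A (f₀ : List Bool → List Bool) (I : LocalMap k n m) (hA : n + 1 ≤ (affList I).length) :
    readOut m (affStr k f₀ I.encode) ∉ I.range := by
  rintro ⟨x, hx⟩
  set rows := (affList I).map (rowL I) with hrows
  have hlen : rows.length = (affList I).length := List.length_map _
  obtain ⟨hlt, hspan⟩ := tStar_spec n rows (by rw [hlen]; exact hA)
  set t := tStar n rows with ht
  have hta : t < (affList I).length := by rw [← hlen]; exact hlt
  have hjs_mem : (affList I)[t] ∈ affList I := List.getElem_mem hta
  have hjs_aff : aff I (affList I)[t] = true := aff_of_mem_affList hjs_mem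
  -- what `jStar` computes
  have hjStar : jStar n ((affList I).map (recOf I)) = ((affList I)[t]).val := by
    unfold jStar rowsOf
    rw [List.map_map, List.map_map]
    change ((affList I).map Fin.val).getD (tStar n ((affList I).map (rowL I))) 0 = _
    rw [← hrows, ← ht, List.getD_eq_getElem?_getD, List.getElem?_map, List.getElem?_eq_getElem hta]
    rfl
  -- the printed string at the affine outputs
  have hy : ∀ j, aff I j = true → I.eval x j = (cbit I j ^^ (j.val == ((affList I)[t]).val)) := by
    intro j hj
    have h := congrFun hx j
    rw [readOut_affStr_A f₀ I hA j, hj, Bool.true_and, hjStar] at h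
    exact h
  -- `χ_x` kills every other affine row
  have hkill : ∀ j, aff I j = true → j ≠ (affList I)[t] → chi x ⬝ᵥ vecL n (rowL I j) = 0 := by
    intro j hj hne
    have h1 := hy j hj
    have hne' : (j.val == ((affList I)[t]).val) = false := by
      rw [beq_eq_false_iff_ne]; exact fun e => hne (Fin.ext e)
    rw [hne', Bool.xor_false] at h1
    have h2 := bit_eval_of_aff I j ((aff_iff I j).1 hj) x
    rw [h1] at h2
    exact (add_eq_left.1 h2.symm)
  -- hence the dependent row
  have hrow_t : rows.getD t [] = rowL I (affList I)[t] := by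
    rw [List.getD_eq_getElem?_getD, hrows, List.getElem?_map, List.getElem?_eq_getElem hta]; rfl
  have hzero : chi x ⬝ᵥ vecL n (rowL I (affList I)[t]) = 0 := by
    rw [← hrow_t]
    rw [inSpan_iff] at hspan
    refine dot_eq_zero_of_mem_span ?_ hspan
    rintro _ ⟨r, hr, rfl⟩
    rw [hrows] at hr
    obtain ⟨s, hsa, hst, rfl⟩ := mem_take_map (rowL I) (affList I) t hr
    refine hkill _ (aff_of_mem_affList (List.getElem_mem hsa)) fun e => ?_
    exact absurd ((nodup_affList I).getElem_inj_iff.1 e) (by omega)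
  -- contradiction at the flipped bit
  have h1 := hy _ hjs_aff
  rw [beq_self_eq_true, Bool.xor_true] at h1
  have h2 := bit_eval_of_aff I _ ((aff_iff I _).1 hjs_aff) x
  rw [hzero, add_zero, h1] at h2
  revert h2
  cases cbit I (affList I)[t] <;> simp [bit]

/-! ## Branch B: the sub-instance of the non-affine outputs -/

/-- The SUB-INSTANCE of the non-affine outputs, on the same inputs. -/
noncomputable def subInst (I : LocalMap k n m) : LocalMap k n (nonList I).length where
  vars t := I.vars ((nonList I).get t)
  table t := I.table ((nonList I).get t)

/-- Members of the list of non-affine outputs are non-affine. -/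
theorem aff_of_mem_nonList {I : LocalMap k n m} {j : Fin m} (h : j ∈ nonList I) : aff I j = false := by
  unfold nonList at h; simpa using (List.mem_filter.1 h).2

/-- Under the side condition «sign-degree `≤ 2` or affine», every table of the sub-instance has sign-degree `≤ 2`. -/
theorem subInst_signDegLE (I : LocalMap k n m) (hI : ∀ j, SignDegLE 2 (I.table j) ∨ IsAffinePred (I.table j))
    (t : Fin (nonList I).length) : SignDegLE 2 ((subInst I).table t) := by
  have hna : aff I ((nonList I).get t) = false := aff_of_mem_nonList (List.get_mem _ _)
  rcases hI ((nonList I).get t) with h | h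
  · exact h
  · have := (aff_iff I _).2 h
    rw [hna] at this
    exact absurd this Bool.false_ne_true

/-- Affine plus non-affine outputs are all the outputs. -/
theorem length_affList_add (I : LocalMap k n m) : (affList I).length + (nonList I).length = m := by
  unfold affList nonList
  have h := List.length_eq_length_filter_add (l := List.finRange m) (fun j => aff I j)
  rw [List.length_finRange] at h
  have e : (List.finRange m).filter (fun j => !(fun j => aff I j) j) = (List.finRange m).filter (fun j => !aff I j) := rfl
  omega

/-- **The machine feeds `f₀` the code of the sub-instance.** -/
theorem subCode_outsOf (I : LocalMap k n m) : subCode k n (outsOf I) = (subInst I).encode := by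
  rw [subCode, subOuts_outsOf, List.length_map, List.map_map, encode_eq]
  have hb : (nonList I).map (blk n ∘ fun j => (tabOf I j, rowOf I j)) =
      (List.finRange (nonList I).length).map (blockOf (subInst I)) := by
    calc (nonList I).map (blk n ∘ fun j => (tabOf I j, rowOf I j))
        = (nonList I).map (blockOf I) := List.map_congr_left fun j _ => blk_out I j
      _ = ((List.finRange (nonList I).length).map (nonList I).get).map (blockOf I) := by rw [← List.ofFn_eq_map, List.ofFn_get]
      _ = (List.finRange (nonList I).length).map (blockOf (subInst I)) := by rw [List.map_map]; rfl
  rw [hb]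

/-- The rank of a non-affine output among the non-affine outputs. -/
theorem findIdx_nonList (I : LocalMap k n m) (t : Fin (nonList I).length) :
    ((nonList I).map Fin.val).findIdx (· == ((nonList I).get t).val) = t.val := by
  have hnd : ((nonList I).map Fin.val).Nodup := ((List.nodup_finRange m).filter _).map Fin.val_injective
  have h := hnd.idxOf_getElem t.val (by rw [List.length_map]; exact t.isLt)
  rw [List.getElem_map] at h
  exact h

/-- **Correctness, branch B** (relative to the hypothesised solver of the all-sign-degree-≤2 instances). -/
theorem correct_B {C₀ : ℕ} {f₀ : List Bool → List Bool}
    (hspec : ∀ n m (I : LocalMap k n m), (∀ j, SignDegLE 2 (I.table j)) → 0 < n → C₀ * n ≤ m →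
      readOut m (f₀ I.encode) ∉ I.range)
    (I : LocalMap k n m) (hI : ∀ j, SignDegLE 2 (I.table j) ∨ IsAffinePred (I.table j)) (hn : 0 < n)
    (hm : (C₀ + 1) * n ≤ m) (hB : ¬ n + 1 ≤ (affList I).length) : readOut m (affStr k f₀ I.encode) ∉ I.range := by
  rintro ⟨x, hx⟩
  have hlen := length_affList_add I
  have hm' : C₀ * n ≤ (nonList I).length := by rw [add_mul, one_mul] at hm; omega
  refine hspec n _ (subInst I) (subInst_signDegLE I hI) hn hm' ⟨x, funext fun t => ?_⟩
  have h := congrFun hx ((nonList I).get t)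
  rw [readOut_affStr_B f₀ I hB, subCode_outsOf, findIdx_nonList, aff_of_mem_nonList (List.get_mem _ _),
    Bool.not_false, Bool.true_and] at h
  exact h

/-- **CORRECTNESS OF THE AFFINE-SPLIT MACHINE**: if `f₀` avoids the range of every `k`-local instance with all
tables of sign-degree `≤ 2`, `n ≥ 1` and `m ≥ C₀·n`, then `affStr k f₀` avoids the range of every instance with
all tables of sign-degree `≤ 2` OR AFFINE, `n ≥ 1` and `m ≥ (C₀ + 1)·n`. -/
theorem affStr_correct {C₀ : ℕ} {f₀ : List Bool → List Bool}
    (hspec : ∀ n m (I : LocalMap k n m), (∀ j, SignDegLE 2 (I.table j)) → 0 < n → C₀ * n ≤ m →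
      readOut m (f₀ I.encode) ∉ I.range)
    (I : LocalMap k n m) (hI : ∀ j, SignDegLE 2 (I.table j) ∨ IsAffinePred (I.table j)) (hn : 0 < n)
    (hm : (C₀ + 1) * n ≤ m) : readOut m (affStr k f₀ I.encode) ∉ I.range := by
  by_cases hA : n + 1 ≤ (affList I).length
  · exact correct_A f₀ I hA
  · exact correct_B hspec I hI hn hm hA

end Summit.PneNP.PneNP.Theorems.AffineSplitFP
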